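import Summits.QuantumFields.BalabanUV.T4Continuum.Support.NE3SlicePoincareAssembly
import Summits.QuantumFields.BalabanUV.T4Continuum.Support.NE3FlatHodgeSplit
import Summits.QuantumFields.BalabanUV.T4Continuum.Support.NE3CoarseInterpolant
import Summits.QuantumFields.BalabanUV.T4Continuum.Support.NE3HodgeCoexactPoincareEnd
import Summits.QuantumFields.BalabanUV.T4Continuum.Support.NE3ProjectedLandauRepr
import HarnessLib

/-!
# NE3ProjTangentLandauPoincare (T⁴ programme, node NE3, row H5b of the owner's ruling ρ-g22-1 (R1)(R3), file 1∕2) — THE CHART'S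
# MIN-NORM SLICE `projTangentLandau L N k` AS A SET, AND THE FLAT (P♮) INEQUALITY ON IT MODULO THE ℂ FRAME BOUND:
# `((L^k)⁻¹)²·dirSq Y F ≤ card n·(9 + 2·2^{d−1} + 72·d·C_F)·curlSq 1 Y F`, `F = periodBox (N·L^k)` — N-FREE, k-FREE

NE3 (node U1b) formalisation swarm `b2b-balaban-t4-ne3-formalise-*`, leaf seat `b2b-balaban-t4-ne3-formalise-leaf-02` (gen 5), row
**H5b** of the owner's rulings ρ-g21-4 (W4) («H5 assembly … leaf-02-g5») and ρ-g22-1 (R1)(R3) («H5b = the Set `projTangentLandau` + the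
MATRIX END on the slice + (ML_w)-flat in curl currency → leaf-02-g5»); ACK∕INTENT in `HOME/CLAIMS.log` 2026-08-20 ≈16:27Z.  WHAT.
After the located error G-ne3p1-g19-1 and rulings ρ-g21-3∕ρ-g21-4, the (ML_w) leaf of the surviving variant (R3) at the flat
background needs the CURL-CURRENCY Poincaré inequality (P♮) `(L^k)⁻²·dirSq Y ≤ C·curlSq 1 Y` with `C` free of `k` and of the torus
size `N`, on the chart's MIN-NORM slice `T_pt(1)` (tangent directions whose flat divergence vanishes OFF the block corners = the
ℓ²-orthogonal complement of the corner-trivial gauge modes `dPot Ξ₀`).  The owner's H5a `NE3SlicePoincareAssembly.sum_norm_sq_le_of_split_interp_frame`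
proves it for ONE ℂ-valued direction as a SOCKET over three rows: (H1) the flat Landau∕Hodge split (row NE3-R2,
`NE3FlatHodgeSplit.exists_flatHodgeSplit`), (H3) the coarse-data interpolant (leaf-01-g5, `NE3CoarseInterpolant`, `C_I = 2^{d−1}`), (H4) the
ℂ frame bound `Σ_{z}‖framePot L k η z‖² ≤ C_F·Σ‖η‖²` (leaf-04, `NE3FramePotBound` ∕ its ℂ twin).  THIS FILE plugs H1 and H3 in BY
NAME, keeps the frame bound as the ONE explicit hypothesis `hFB` (file 2 discharges it with leaf-04-g5's `NE3FramePotBoundComplex`,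
`C_F = 12·Dfp d L`), and takes the complex core ENTRYWISE to matrices exactly as (72S) `NE3BlockPoincareLandauEnd` ∕ H2-END
`NE3HodgeCoexactPoincareEnd` do.  All [folklore], 0 sorry; ONE DATA def (the Set of record (R1)):
§1 **`projTangentLandau L N k : Set (Site d → Fin d → Matrix n n ℂ)`** (skew ∧ `IsPeriodicDir X (N·L^k)` ∧ `TangentIter L (k−1) flatCfg X`
   ∧ `∀ z v, v ∈ periodBox (L^k) → v ≠ 0 → flatDiv X ((L^k)•z + v) = 0` — ρ-g22-1 (R1) VERBATIM), `iterate_Tcoarse_eq_zero_of_mem`,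
   `flatDiv_apply_entry`, and **`exists_cornerGauge_mem_projTangentLandau`** (leaf-01-g5's Φ6-pt `NE3ProjectedLandauRepr.exists_cornerGauge_projLandau`
   read as membership: the chart's L1 representative lands IN the slice);
§2 **`sum_norm_sq_le_planeCurl_of_frameBound`** — the ℂ core for one direction: `L, N ≥ 1`, `(Tcoarse L)^[k] Y = 0`, slice clause, the
   frame bound `hFB` with constant `CF ≥ 0` ⟹ `Σ_{periodBox (L^k·N)} Σ_κ ‖Y x κ‖² ≤ (9 + 2·2^{d−1} + 72·d·CF)·(L^k)²·Σ_x Σ_π ‖curl_π Y x‖²`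
   (H1 → `ζ`, `η := Y − dPot ζ`; H3 on the datum `−ψ`, `ψ = framePot L k η − ζ∘(L^k•)`, `N`-periodic by `framePot_add_period`; H5a);
§3 matrices, `[Nonempty n]`: **`sum_nhsNormSq_le_curl_of_frameBound`** (Hilbert–Schmidt currency, no factor `n`) and
   **`weightedPoincare_projTangentLandau_of_frameBound`**: `∀ Y ∈ projTangentLandau L N k,
   ((L^k)⁻¹)²·dirSq Y (periodBox (N·L^k)) ≤ (card n·(9 + 2·2^{d−1} + 72·d·CF))·curlSq flatCfg Y (periodBox (N·L^k))` — the (P_U)-type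
   hypothesis of `NE3WeightedCoercivityTransfer` at `U = 1` on the chart's slice, N-FREE, k-FREE given `hFB`.
HONEST FRAMING.  Flat finite-torus assembly in OUR frame; the frame bound is a HYPOTHESIS here (discharged in file 2 for `d ≥ 3`,
`L ≥ 2`); nothing about Bałaban's minimisers; (P♮)∕(ML_w) at the CURVED background `W = cavg L U_B`, T-E_w and NE3 are NOT proved; spine
PROVED 0∕9; finite T⁴ rung (B)+1 — NOT infinite volume, NOT mass gap, NOT BetaPertH, NOT Clay.  ABSOLUTE RULE kept: no printed sentence
is a hypothesis (context only: [Balaban1985PropagatorsII] Thm 3.3 (3.46); [Balaban1985Averaging] (42), (47)–(48) p. 25).  PLACEMENT: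
`Summits/QuantumFields/BalabanUV/`; imports the owner's H5a, NE3-R2's H1, leaf-01-g5's H3 and Φ6-pt, leaf-03-g7's H2-END (entrywise
tools) BY NAME; moves nothing.  HONEST DEPENDENCY: continuum YM on T⁴ ⇐ BetaPertH ∧ nine spine estimates (0/9 proved); BetaPertH ⇐
(D1) ∧ (D4) ∧ CAP+tail; G-an2-4 gates asym, D1 and NE2/3/4.
-/

set_option autoImplicit false

open scoped BigOperators Matrix.Norms.L2Operator
open Finset

namespace Summit.QuantumFields.BalabanUV.T4Continuum.NE3ProjTangentLandauPoincare

open Literature.MathematicalPhysics.QuantumFieldTheory.Balaban1983to89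
open B7Prop1Explicit
open T4AveragingDeficitWall (IsSkewDir Plane curlAt curl curlSq dirSq)
open T4AveragingDeficitWallBoundary (periodBox mem_periodBox card_periodBox)
open AveragingDeficitPeriodicCounting (IsPeriodicDir)
open AveragingDeficitMultiLevelPrep (TangentIter)
open MinimalActionWitness (flatCfg)
open SmoothRefineNeutral (Tcoarse)
open NE3TangentNoGoWords (dPot)
open NE3CoercivityScaling (flatDiv)
open NE3TangentFlatStructure (framePot framePot_add_period dPot_add_period iterate_Tcoarse_eq_zero_of_tangentIter
  iterate_Tcoarse_entry_eq_zero)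
open MatrixNorms (nhsNormSq nhsNormSq_nonneg)
open NE3BlockPoincareTangent (sum_entries_eq_card_mul_nhs dirSq_le_card_mul_sum_nhs)
open NE3LatticeWeitzenbock (curlAt_flatCfg)
open NE3FlatWeightedCoercive (sum_nhsNormSq_curl_le_curlSq)
open NE3HodgeCoexactPoincareEnd (sum_entries_curl_eq_card_mul_nhs)
open NE3FlatHodgeSplit (exists_flatHodgeSplit)
open NE3CoarseInterpolant (interp_corner interp_add_period sum_normSq_dPot_interp_le)
open SmoothRefineInterp (interp)
open NE3SlicePoincareAssembly (sum_norm_sq_le_of_split_interp_frame)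
open NE3ProjectedLandauRepr (exists_cornerGauge_projLandau)

noncomputable section

variable {d : ℕ}

/-! ## §1 The chart's min-norm slice at the flat background, as a Set (ruling ρ-g22-1 (R1), verbatim) -/

section SliceSet

variable {n : Type*} [Fintype n] [DecidableEq n]

/-- **THE PROJECTED-LANDAU (MIN-NORM) TANGENT SLICE** at `k` levels on the torus of side `N·L^k` — the chart's slice `T_pt(1)` of
rulings ρ-g21-4 (W2) ∕ ρ-g22-1 (R1): skew, `(N·L^k)`-periodic directions, TANGENT to the `k`-fold flat average, whose flat backward
divergence VANISHES OFF THE BLOCK CORNERS (`flatDiv X (L^k•z + v) = 0` for `v ∈ [0,L^k)^d`, `v ≠ 0`) — `flatTangentLandau` with the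
Landau clause restricted off corners; equivalently the `ℓ²`-orthogonal complement of the corner-trivial gauge modes `dPot Ξ₀` inside
the flat `k`-fold tangent space (`NE3SlicePoincareAssembly.sum_norm_sq_le_of_projLandau`). [folklore] -/
def projTangentLandau (L N k : ℕ) : Set (Site d → Fin d → Matrix n n ℂ) :=
  {X | IsSkewDir X ∧ IsPeriodicDir X ((N * L ^ k : ℕ) : ℤ) ∧ TangentIter L (k - 1) flatCfg X ∧
      ∀ (z v : Site d), v ∈ periodBox (d := d) (L ^ k) → v ≠ 0 → flatDiv X (((L ^ k : ℕ) : ℤ) • z + v) = 0}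

/-- Members of the slice are in `ker (Tcoarse L)^[k]` (`L, k ≥ 1`). [folklore] -/
theorem iterate_Tcoarse_eq_zero_of_mem {L N k : ℕ} (hL : 1 ≤ L) (hk : 1 ≤ k) {X : Site d → Fin d → Matrix n n ℂ}
    (hX : X ∈ projTangentLandau (d := d) (n := n) L N k) : (Tcoarse L)^[k] X = 0 := by
  have h := iterate_Tcoarse_eq_zero_of_tangentIter hL (k - 1) X hX.2.2.1
  rwa [Nat.sub_add_cancel hk] at h

omit [Fintype n] [DecidableEq n] in
/-- The flat divergence read in an entry, pointwise. [folklore] -/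
theorem flatDiv_apply_entry (Y : Site d → Fin d → Matrix n n ℂ) (x : Site d) (p q : n) :
    flatDiv Y x p q = ∑ κ : Fin d, (Y x κ p q - Y (x - e κ) κ p q) := by
  simp only [flatDiv, Matrix.sum_apply, Matrix.sub_apply]

/-- **THE CHART'S L1 REPRESENTATIVE LANDS IN THE SLICE**: leaf-01-g5's Φ6-pt `NE3ProjectedLandauRepr.exists_cornerGauge_projLandau`
read as Set membership — every skew `(N·L^k)`-periodic `k`-fold flat tangent direction is moved INTO `projTangentLandau L N k` by
`dPot` of a corner-trivial 𝔲(n)-valued periodic gauge (`L, N, k ≥ 1`). [folklore] -/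
theorem exists_cornerGauge_mem_projTangentLandau {L N k : ℕ} (hL : 1 ≤ L) (hN : 1 ≤ N) (hk : 1 ≤ k)
    {Y : Site d → Fin d → Matrix n n ℂ} (hYs : IsSkewDir Y) (hYP : IsPeriodicDir Y ((N * L ^ k : ℕ) : ℤ))
    (hYT : TangentIter L (k - 1) (flatCfg (d := d) (n := n)) Y) :
    ∃ ξ : Site d → Matrix n n ℂ, (∀ x, ξ x ∈ skewAdjoint (Matrix n n ℂ))
      ∧ (∀ (x : Site d) (τ : Fin d), ξ (x + ((N * L ^ k : ℕ) : ℤ) • e τ) = ξ x)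
      ∧ (∀ w : Site d, ξ (((L ^ k : ℕ) : ℤ) • w) = 0)
      ∧ (fun x μ => Y x μ + dPot ξ x μ) ∈ projTangentLandau (d := d) (n := n) L N k := by
  obtain ⟨ξ, hξs, hξP, hξ0, h1, h2, h3, h4⟩ := exists_cornerGauge_projLandau hL hN hk hYs hYP hYT
  exact ⟨ξ, hξs, hξP, hξ0, h1, h2, h3, h4⟩

end SliceSet

/-! ## §2 The complex core: (P♮)-flat for ONE tangent direction in the slice, over H1 + H3 + H5a, modulo the frame bound -/

/-- **(P♮)-FLAT ON THE MIN-NORM SLICE, COMPLEX VALUES, MODULO THE ℂ FRAME BOUND**.  `L, N ≥ 1`, `k`, a constant `CF ≥ 0` with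
`Σ_{z∈periodBox N} ‖framePot L k η z‖² ≤ CF·Σ_{x∈periodBox (L^k·N)} Σ_κ ‖η x κ‖²` for every `(L^k·N)`-periodic ℂ-valued `η` (row H4's
ℂ twin); then every `(L^k·N)`-periodic `Y : Site d → Fin d → ℂ` with `(Tcoarse L)^[k] Y = 0` whose flat divergence vanishes off the
block corners obeys `Σ_{x∈periodBox (L^k·N)} Σ_κ ‖Y x κ‖² ≤ (9 + 2·2^{d−1} + 72·d·CF)·(L^k)²·Σ_x Σ_π ‖curl_π Y x‖²`.  Assembly of
NE3-R2's H1 `NE3FlatHodgeSplit.exists_flatHodgeSplit` (the split `Y = η + dPot ζ`), leaf-01-g5's H3 `NE3CoarseInterpolant` (the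
interpolant of the datum `−ψ`, `C_I = 2^{d−1}`) and the owner's H5a socket `NE3SlicePoincareAssembly.sum_norm_sq_le_of_split_interp_frame`
BY NAME. [folklore] -/
theorem sum_norm_sq_le_planeCurl_of_frameBound {L : ℕ} (hL : 1 ≤ L) {N : ℕ} (hN : 1 ≤ N) (k : ℕ) {CF : ℝ} (hCF : 0 ≤ CF)
    (hFB : ∀ η : Site d → Fin d → ℂ, (∀ (x : Site d) (τ μ : Fin d), η (x + ((L ^ k * N : ℕ) : ℤ) • e τ) μ = η x μ) →
      ∑ z ∈ periodBox (d := d) N, ‖framePot L k η z‖ ^ 2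
        ≤ CF * ∑ x ∈ periodBox (d := d) (L ^ k * N), ∑ κ : Fin d, ‖η x κ‖ ^ 2)
    (Y : Site d → Fin d → ℂ) (hY : ∀ (x : Site d) (τ μ : Fin d), Y (x + ((L ^ k * N : ℕ) : ℤ) • e τ) μ = Y x μ)
    (hT : (Tcoarse L)^[k] Y = 0)
    (hslice : ∀ (z v : Site d), v ∈ periodBox (d := d) (L ^ k) → v ≠ 0 →
      ∑ κ : Fin d, (Y (((L ^ k : ℕ) : ℤ) • z + v) κ - Y (((L ^ k : ℕ) : ℤ) • z + v - e κ) κ) = 0) :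
    ∑ x ∈ periodBox (d := d) (L ^ k * N), ∑ κ : Fin d, ‖Y x κ‖ ^ 2
      ≤ (9 + 2 * (2 : ℝ) ^ (d - 1) + 72 * d * CF) * ((L : ℝ) ^ k) ^ 2 * ∑ x ∈ periodBox (d := d) (L ^ k * N), ∑ π : Plane d,
          ‖(Y (x + e π.1.1) π.1.2 - Y x π.1.2) - (Y (x + e π.1.2) π.1.1 - Y x π.1.1)‖ ^ 2 := by
  have hM : 1 ≤ L ^ k := Nat.one_le_pow _ _ hL
  have hP : 1 ≤ L ^ k * N := Nat.one_le_iff_ne_zero.mpr (Nat.mul_ne_zero (by omega) (by omega))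
  have hcastP : ((L : ℤ) ^ k * (N : ℤ)) = ((L ^ k * N : ℕ) : ℤ) := by push_cast; ring
  have hcast : ((L : ℤ) ^ k) = ((L ^ k : ℕ) : ℤ) := by push_cast; ring
  -- (H1) the Landau∕Hodge split `Y = η + dPot ζ`, `η` flat-divergence-free
  obtain ⟨ζ, hζ, hdiv⟩ := exists_flatHodgeSplit hP Y hY
  set η : Site d → Fin d → ℂ := fun x μ => Y x μ - dPot ζ x μ with hη_def
  have hpt : ∀ (x : Site d) (κ : Fin d), η x κ + dPot ζ x κ = Y x κ := fun x κ => by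
    simp only [hη_def, sub_add_cancel]
  have hfun : (fun x μ => η x μ + dPot ζ x μ) = Y := funext fun x => funext fun μ => hpt x μ
  have hηP : ∀ (x : Site d) (τ μ : Fin d), η (x + ((L ^ k * N : ℕ) : ℤ) • e τ) μ = η x μ := fun x τ μ => by
    simp only [hη_def, hY x τ μ, dPot_add_period hζ x τ μ]
  have hη' : ∀ (y : Site d) (τ μ : Fin d), η (y + ((L : ℤ) ^ k * (N : ℤ)) • e τ) μ = η y μ := fun y τ μ => by
    rw [hcastP]; exact hηP y τ μ
  have hζ' : ∀ (y : Site d) (τ : Fin d), ζ (y + ((L : ℤ) ^ k * (N : ℤ)) • e τ) = ζ y := fun y τ => by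
    rw [hcastP]; exact hζ y τ
  -- (H3) the interpolant of the datum `−ψ`, `ψ z = framePot L k η z − ζ((L^k)•z)`
  set m : Site d → ℂ := fun w => -(framePot L k η w - ζ (((L : ℤ) ^ k) • w)) with hm_def
  have hm : ∀ (z : Site d) (τ : Fin d), m (z + (N : ℤ) • e τ) = m z := by
    intro z τ
    simp only [hm_def]
    rw [framePot_add_period L k η hη' z τ, smul_add, smul_smul, hζ']
  set I : Site d → ℂ := interp (L ^ k) Finset.univ m with hI_def
  have hIc : ∀ z : Site d, I (((L ^ k : ℕ) : ℤ) • z) = -(framePot L k η z - ζ (((L : ℤ) ^ k) • z)) := fun z =>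
    interp_corner hM Finset.univ m z
  have hI : ∀ (x : Site d) (τ : Fin d), I (x + ((L ^ k * N : ℕ) : ℤ) • e τ) = I x := fun x τ =>
    interp_add_period hM Finset.univ hm x τ
  have hIe := sum_normSq_dPot_interp_le (𝔸 := ℂ) hM hN hm
  -- (H4) the frame bound for `η`
  have hF := hFB η hηP
  -- tangency and the slice clause in the `η + dPot ζ` spelling
  have hT' : (Tcoarse L)^[k] (fun x μ => η x μ + dPot ζ x μ) = 0 := by rw [hfun]; exact hT
  have hslice' : ∀ (z v : Site d), v ∈ periodBox (d := d) (L ^ k) → v ≠ 0 →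
      ∑ κ : Fin d, ((η (((L ^ k : ℕ) : ℤ) • z + v) κ + dPot ζ (((L ^ k : ℕ) : ℤ) • z + v) κ)
        - (η (((L ^ k : ℕ) : ℤ) • z + v - e κ) κ + dPot ζ (((L ^ k : ℕ) : ℤ) • z + v - e κ) κ)) = 0 := by
    intro z v hv hv0
    simp only [hpt]
    exact hslice z v hv hv0
  have h := sum_norm_sq_le_of_split_interp_frame hL hN k η ζ I (by positivity : (0 : ℝ) ≤ (2 : ℝ) ^ (d - 1)) hCF hηP hζ hI
    hT' hslice' hdiv hIc hIe hF
  simp only [hpt] at h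
  exact h

/-! ## §3 The matrix END on the slice Set: entrywise, then Hilbert–Schmidt, then operator norm -/

section Matrices

variable {n : Type*} [Fintype n] [DecidableEq n] [Nonempty n]

/-- **(P♮)-FLAT, HILBERT–SCHMIDT CURRENCY, MODULO THE ℂ FRAME BOUND**: for `L, N, k ≥ 1` and `Y ∈ projTangentLandau L N k`,
`Σ_{x∈periodBox (N·L^k)} Σ_κ nhsNormSq (Y x κ) ≤ (9 + 2·2^{d−1} + 72·d·CF)·(L^k)²·Σ_x Σ_π nhsNormSq (curlAt 1 Y x π)` — the complex
core taken ENTRYWISE exactly as (72S) ∕ H2-END do (`iterate_Tcoarse_entry_eq_zero`, `sum_entries_eq_card_mul_nhs`,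
`sum_entries_curl_eq_card_mul_nhs`); no factor `n`, no `N`, no `k`. [folklore] -/
theorem sum_nhsNormSq_le_curl_of_frameBound {L N k : ℕ} (hL : 1 ≤ L) (hN : 1 ≤ N) (hk : 1 ≤ k) {CF : ℝ} (hCF : 0 ≤ CF)
    (hFB : ∀ η : Site d → Fin d → ℂ, (∀ (x : Site d) (τ μ : Fin d), η (x + ((L ^ k * N : ℕ) : ℤ) • e τ) μ = η x μ) →
      ∑ z ∈ periodBox (d := d) N, ‖framePot L k η z‖ ^ 2
        ≤ CF * ∑ x ∈ periodBox (d := d) (L ^ k * N), ∑ κ : Fin d, ‖η x κ‖ ^ 2)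
    {Y : Site d → Fin d → Matrix n n ℂ} (hYmem : Y ∈ projTangentLandau (d := d) (n := n) L N k) :
    ∑ x ∈ periodBox (d := d) (N * L ^ k), ∑ κ : Fin d, nhsNormSq (Y x κ)
      ≤ (9 + 2 * (2 : ℝ) ^ (d - 1) + 72 * d * CF) * ((L : ℝ) ^ k) ^ 2
          * ∑ x ∈ periodBox (d := d) (N * L ^ k), ∑ π : Plane d,
              nhsNormSq (curlAt (flatCfg (d := d) (n := n)) Y x π.1.1 π.1.2) := by
  have hT : (Tcoarse L)^[k] Y = 0 := iterate_Tcoarse_eq_zero_of_mem hL hk hYmem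
  obtain ⟨-, hYper, -, hdiv⟩ := hYmem
  rw [show N * L ^ k = L ^ k * N from Nat.mul_comm _ _]
  set F := periodBox (d := d) (L ^ k * N) with hF
  have hent : ∀ pq : n × n, ∑ x ∈ F, ∑ κ : Fin d, ‖Y x κ pq.1 pq.2‖ ^ 2
      ≤ (9 + 2 * (2 : ℝ) ^ (d - 1) + 72 * d * CF) * ((L : ℝ) ^ k) ^ 2
          * ∑ x ∈ F, ∑ π : Plane d, ‖curlAt (flatCfg (d := d) (n := n)) Y x π.1.1 π.1.2 pq.1 pq.2‖ ^ 2 := by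
    intro pq
    have hper : ∀ (x : Site d) (τ μ : Fin d),
        (fun y ν => Y y ν pq.1 pq.2) (x + ((L ^ k * N : ℕ) : ℤ) • e τ) μ = (fun y ν => Y y ν pq.1 pq.2) x μ := by
      intro x τ μ
      simp only
      rw [show (L ^ k * N : ℕ) = N * L ^ k from Nat.mul_comm _ _, hYper x τ μ]
    have hslicepq : ∀ (z v : Site d), v ∈ periodBox (d := d) (L ^ k) → v ≠ 0 →
        ∑ κ : Fin d, ((fun y ν => Y y ν pq.1 pq.2) (((L ^ k : ℕ) : ℤ) • z + v) κ
          - (fun y ν => Y y ν pq.1 pq.2) (((L ^ k : ℕ) : ℤ) • z + v - e κ) κ) = 0 := by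
      intro z v hv hv0
      have h := congrArg (fun A : Matrix n n ℂ => A pq.1 pq.2) (hdiv z v hv hv0)
      simpa only [flatDiv_apply_entry, Matrix.zero_apply] using h
    have h := sum_norm_sq_le_planeCurl_of_frameBound hL hN k hCF hFB (fun y ν => Y y ν pq.1 pq.2) hper
      (iterate_Tcoarse_entry_eq_zero L hT pq.1 pq.2) hslicepq
    simpa only [curlAt_flatCfg, Matrix.sub_apply] using h
  have hsum := Finset.sum_le_sum fun pq (_ : pq ∈ (Finset.univ : Finset (n × n))) => hent pq
  rw [← Finset.mul_sum, sum_entries_eq_card_mul_nhs, sum_entries_curl_eq_card_mul_nhs] at hsum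
  have hn : (0 : ℝ) < Fintype.card n := by exact_mod_cast Fintype.card_pos
  rw [mul_left_comm] at hsum
  exact le_of_mul_le_mul_left hsum hn

/-- **(P♮)-FLAT ON THE CHART'S MIN-NORM SLICE, OPERATOR-NORM CURRENCY, MODULO THE ℂ FRAME BOUND**: for `L, N, k ≥ 1`,
`∀ Y ∈ projTangentLandau L N k, ((L^k)⁻¹)²·dirSq Y F ≤ card n·(9 + 2·2^{d−1} + 72·d·CF)·curlSq 1 Y F`, `F = periodBox (N·L^k)` — the
(P_U)-type hypothesis of `NE3WeightedCoercivityTransfer` at `U = 1` (one factor `card n` from `dirSq_le_card_mul_sum_nhs`, HS curl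
`≤` operator curl by `sum_nhsNormSq_curl_le_curlSq`). [folklore] -/
theorem weightedPoincare_projTangentLandau_of_frameBound {L N k : ℕ} (hL : 1 ≤ L) (hN : 1 ≤ N) (hk : 1 ≤ k) {CF : ℝ}
    (hCF : 0 ≤ CF)
    (hFB : ∀ η : Site d → Fin d → ℂ, (∀ (x : Site d) (τ μ : Fin d), η (x + ((L ^ k * N : ℕ) : ℤ) • e τ) μ = η x μ) →
      ∑ z ∈ periodBox (d := d) N, ‖framePot L k η z‖ ^ 2
        ≤ CF * ∑ x ∈ periodBox (d := d) (L ^ k * N), ∑ κ : Fin d, ‖η x κ‖ ^ 2) :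
    ∀ Y ∈ projTangentLandau (d := d) (n := n) L N k,
      (((L : ℝ) ^ k)⁻¹) ^ 2 * dirSq Y (periodBox (d := d) (N * L ^ k))
        ≤ (Fintype.card n * (9 + 2 * (2 : ℝ) ^ (d - 1) + 72 * d * CF))
          * curlSq (flatCfg (d := d) (n := n)) Y (periodBox (d := d) (N * L ^ k)) := by
  intro Y hY
  set F := periodBox (d := d) (N * L ^ k) with hF
  set C : ℝ := 9 + 2 * (2 : ℝ) ^ (d - 1) + 72 * d * CF with hC
  have hC0 : 0 ≤ C := by positivity
  have hσ : (0 : ℝ) < ((L : ℝ) ^ k) ^ 2 := by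
    have : (0 : ℝ) < (L : ℝ) := by exact_mod_cast (by omega : 0 < L)
    positivity
  have h := sum_nhsNormSq_le_curl_of_frameBound hL hN hk hCF hFB hY
  have hn : (0 : ℝ) ≤ Fintype.card n := Nat.cast_nonneg _
  have h1 : dirSq Y F ≤ Fintype.card n * (C * ((L : ℝ) ^ k) ^ 2 * curlSq (flatCfg (d := d) (n := n)) Y F) :=
    calc dirSq Y F ≤ Fintype.card n * ∑ x ∈ F, ∑ κ : Fin d, nhsNormSq (Y x κ) := dirSq_le_card_mul_sum_nhs Y F
      _ ≤ Fintype.card n * (C * ((L : ℝ) ^ k) ^ 2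
            * ∑ x ∈ F, ∑ π : Plane d, nhsNormSq (curlAt (flatCfg (d := d) (n := n)) Y x π.1.1 π.1.2)) :=
          mul_le_mul_of_nonneg_left h hn
      _ ≤ Fintype.card n * (C * ((L : ℝ) ^ k) ^ 2 * curlSq (flatCfg (d := d) (n := n)) Y F) :=
          mul_le_mul_of_nonneg_left (mul_le_mul_of_nonneg_left (sum_nhsNormSq_curl_le_curlSq Y F) (by positivity)) hn
  rw [inv_pow, inv_mul_le_iff₀ hσ]
  calc dirSq Y F ≤ Fintype.card n * (C * ((L : ℝ) ^ k) ^ 2 * curlSq (flatCfg (d := d) (n := n)) Y F) := h1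
    _ = ((L : ℝ) ^ k) ^ 2 * (Fintype.card n * C * curlSq (flatCfg (d := d) (n := n)) Y F) := by ring

end Matrices

end

end Summit.QuantumFields.BalabanUV.T4Continuum.NE3ProjTangentLandauPoincare
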